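import Summits.SmoothPoincare4.SmoothPoincare4.Theses.EntropyRung
import Summits.SmoothPoincare4.SmoothPoincare4.Theorems.EntropyRungSubcylindricalExistenceCapMetricVolume
import Summits.SmoothPoincare4.SmoothPoincare4.Theorems.EntropyRungSubcylindricalExistenceSetIntegralFlatChart
import Literature.Geometry.Lorentzian.VolumeChartIntegral
import Mathlib.Analysis.SpecialFunctions.JapaneseBracket
import Mathlib.MeasureTheory.Measure.Haar.NormedSpace
import HarnessLib

/-!
# The volume of the capped metric grows like `K²` — Schwarzschild gauge
(crux stmt-SmoothPoincare4-10871 `EntropyRung.SubcylindricalExistence`, line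
`green-blowup-conformal-entropy`, reshape R-c3 "Schwarzschild gauge", stub S5'
`stub_capMetricVolumeSchwarzschild`)

Let `(g, p, G)` be Green data on a closed `4`-manifold `M` in the flat gauge WITH MASS at `p`
(`φ = extChartAt (𝓡 4) p`, `y₀ = φ p`, the closed chart ball `B̄(y₀, r) ⊆ φ.target`, `φ⁻¹` a
`g`-isometry on it, and `G(φ⁻¹ y) = a/‖y − y₀‖² + b` on `B̄(y₀, r) ∖ {y₀}` with `a > 0`, `b ≥ 0`).
Then there are constants `C₁, C₂` (depending on `M, g, p, G, a, b, r` only) such that for every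
`K > 0` and every smooth `ψ` with `ψ = 4KG/(4K + G)` off `p` and `ψ(p) = 4K`,

  `Vol(ψ² g) = ∫_M ψ⁴ dV_g ≤ C₁ + C₂ K²`.

Proof (the `b = 0` case is c2's `EntropyRungSubcylindricalExistenceCapMetricVolume.lean`, whose
Euclidean estimate `CapMetricVolume.setIntegral_le_of_le_capProfile` we reuse). Split `M` into the
chart ball `B = φ⁻¹ B̄(y₀, r)` and its complement.
* Off `B` (indeed off the open chart ball `U ⊆ B`, whose complement is compact and misses `p`)
  `|G| ≤ C`, and `0 ≤ ψ = 4KG/(4K+G) ≤ G ≤ C` off `p`, so `∫_{Bᶜ} ψ⁴ ≤ C⁴ Vol_g(M)`.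
* On `B` the Riemannian measure is Lebesgue measure in the chart (S0b,
  `stub_setIntegralFlatChart`): `∫_B ψ⁴ dV_g = ∫_{B̄} ψ(φ⁻¹ y)⁴ dy`. With `ρ = ‖y − y₀‖ ≠ 0`,
  `ψ(φ⁻¹ y) = 4K(a/ρ² + b)/(4K + a/ρ² + b) ≤ 4Ka/(4Kρ² + a) + b` (the map `t ↦ 4Kt/(4K+t)` is
  `1`-Lipschitz and increasing on `t > 0`), and at `y = y₀` both sides read `4K ≤ 4K + b`. Hence
  `ψ⁴ ≤ (X + b)⁴ ≤ 8X⁴ + 8b⁴` with `X` c2's profile, and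
  `∫_{B̄} ψ⁴ ≤ 8 · 16 a² (∫_{ℝ⁴} (1 + ‖w‖²)⁻⁴ dw) K² + 8 b⁴ vol(B̄(y₀, r))`.
So `C₁ = C⁴ Vol_g(M) + 8 b⁴ vol(B̄(y₀, r))` and `C₂ = 128 a² ∫_{ℝ⁴} (1 + ‖w‖²)⁻⁴ dw`.

References: [LeeParker1987] §6 (the conformal blow-up `G^{4/(n−2)} g`, its asymptotics with
mass term) and §7. Everything below is elementary measure theory; everything is proved; no
definition, no named fact.
-/

noncomputable section

-- the registered namespace `Summit.SmoothPoincare4.SmoothPoincare4.Theorems` repeats a component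
set_option linter.dupNamespace false

open scoped Manifold ContDiff Topology RealInnerProductSpace
open Set Filter MeasureTheory
open Literature.Geometry.Lorentzian

namespace Summit.SmoothPoincare4.SmoothPoincare4.Theorems

namespace CapMetricVolumeSchwarzschild

open CapMetricVolume

/-! ### Pointwise inequalities -/

/-- The cap map `t ↦ 4Kt/(4K + t)` is increasing and `1`-Lipschitz on `t > 0`:
`4K(t + b)/(4K + t + b) ≤ 4Kt/(4K + t) + b` for `K, t > 0`, `b ≥ 0`. [folklore] -/
theorem cap_add_le {K t b : ℝ} (hK : 0 < K) (ht : 0 < t) (hb : 0 ≤ b) :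
    4 * K * (t + b) / (4 * K + (t + b)) ≤ 4 * K * t / (4 * K + t) + b := by
  rw [div_add' _ _ _ (by positivity : (4 * K + t) ≠ 0),
    div_le_div_iff₀ (by positivity) (by positivity)]
  nlinarith [mul_nonneg (mul_nonneg hK.le hb) ht.le, mul_nonneg hK.le (sq_nonneg b),
    mul_nonneg hb (sq_nonneg t), mul_nonneg (sq_nonneg b) ht.le, mul_pos hK ht]

/-- **The Schwarzschild cap profile is below the massless one plus the mass**:
`4K(a/ρ² + b)/(4K + a/ρ² + b) ≤ 4Ka/(4Kρ² + a) + b` for `K, a > 0`, `b ≥ 0`, `ρ ≠ 0`.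
[folklore] -/
theorem capProfile_le {K a b ρ : ℝ} (hK : 0 < K) (ha : 0 < a) (hb : 0 ≤ b) (hρ : ρ ≠ 0) :
    4 * K * (a / ρ ^ 2 + b) / (4 * K + (a / ρ ^ 2 + b)) ≤
      4 * K * a / (4 * K * ρ ^ 2 + a) + b := by
  have hρ2 : 0 < ρ ^ 2 := by positivity
  have ht : 0 < a / ρ ^ 2 := div_pos ha hρ2
  have h4 : 4 * K + a / ρ ^ 2 ≠ 0 := by positivity
  have h5 : 4 * K * ρ ^ 2 + a ≠ 0 := by positivity
  have hX : 4 * K * (a / ρ ^ 2) / (4 * K + a / ρ ^ 2) = 4 * K * a / (4 * K * ρ ^ 2 + a) := by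
    rw [div_eq_div_iff h4 h5]
    field_simp
  rw [← hX]
  exact cap_add_le hK ht hb

/-! ### The Euclidean estimate with mass -/

/-- **The Euclidean estimate (Schwarzschild gauge).** If `0 ≤ f ≤ 4Ka/(4K‖y − y₀‖² + a) + b` on
the closed ball `B̄(y₀, r)` of `ℝ⁴` (`a, K > 0`), then
`∫_{B̄} f⁴ ≤ 8 b⁴ vol(B̄) + 128 a² (∫_{ℝ⁴} (1 + ‖w‖²)⁻⁴ dw) K²`:
`f⁴ ≤ (X + b)⁴ ≤ 8X⁴ + 8b⁴` (power mean) and c2's estimate `∫ X⁴ ≤ 16 a² (∫ k) K²` for the massless profile `X`.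
[folklore] -/
theorem setIntegral_pow_four_le (y₀ : EuclideanSpace ℝ (Fin 4)) {a b K r : ℝ} (ha : 0 < a)
    (hK : 0 < K) (f : EuclideanSpace ℝ (Fin 4) → ℝ)
    (hf0 : ∀ y ∈ Metric.closedBall y₀ r, 0 ≤ f y)
    (hf : ∀ y ∈ Metric.closedBall y₀ r, f y ≤ 4 * K * a / (4 * K * ‖y - y₀‖ ^ 2 + a) + b) :
    ∫ y in Metric.closedBall y₀ r, f y ^ 4 ≤
      8 * b ^ 4 * (volume : Measure (EuclideanSpace ℝ (Fin 4))).real (Metric.closedBall y₀ r) +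
        128 * a ^ 2 * (∫ w : EuclideanSpace ℝ (Fin 4), ((1 + ‖w‖ ^ 2) ^ 4)⁻¹) * K ^ 2 := by
  set s := Metric.closedBall y₀ r with hs
  have hsm : MeasurableSet s := measurableSet_closedBall
  -- the massless profile `X` and the majorant `8 X⁴ + 8 b⁴`
  set X : EuclideanSpace ℝ (Fin 4) → ℝ := fun y ↦ 4 * K * a / (4 * K * ‖y - y₀‖ ^ 2 + a) with hXd
  have hXc : Continuous X := by
    refine continuous_const.div (by fun_prop) fun y ↦ ?_
    positivity
  have hX0 : ∀ y, 0 ≤ X y := fun y ↦ by positivity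
  have hXint : IntegrableOn (fun y ↦ X y ^ 4) s volume :=
    (hXc.pow 4).continuousOn.integrableOn_compact (isCompact_closedBall y₀ r)
  have hcint : IntegrableOn (fun _ : EuclideanSpace ℝ (Fin 4) ↦ 8 * b ^ 4) s volume :=
    integrableOn_const measure_closedBall_lt_top.ne
  have hmaj : IntegrableOn (fun y ↦ 8 * X y ^ 4 + 8 * b ^ 4) s volume :=
    (hXint.const_mul 8).add hcint
  -- `(x + y)⁴ ≤ 8x⁴ + 8y⁴`: `8(x⁴ + y⁴) − (x + y)⁴ = (x − y)²(5(x + y)² + 2x² + 2y²)`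
  have hle : ∀ y ∈ s, f y ^ 4 ≤ 8 * X y ^ 4 + 8 * b ^ 4 := by
    intro y hy
    calc f y ^ 4 ≤ (X y + b) ^ 4 := pow_le_pow_left₀ (hf0 y hy) (hf y hy) 4
      _ ≤ 8 * X y ^ 4 + 8 * b ^ 4 := by
          nlinarith [mul_nonneg (sq_nonneg (X y - b)) (sq_nonneg (X y + b)),
            mul_nonneg (sq_nonneg (X y - b)) (sq_nonneg (X y)),
            mul_nonneg (sq_nonneg (X y - b)) (sq_nonneg b)]
  have hXle := setIntegral_le_of_le_capProfile y₀ ha hK hsm (fun y ↦ X y ^ 4)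
    (fun y _ ↦ by positivity) (fun y _ ↦ le_rfl)
  calc ∫ y in s, f y ^ 4 ≤ ∫ y in s, (8 * X y ^ 4 + 8 * b ^ 4) := by
        refine integral_mono_of_nonneg ?_ hmaj ?_
        · exact (ae_restrict_iff' hsm).2 (ae_of_all _ fun y _ ↦ by positivity)
        · exact (ae_restrict_iff' hsm).2 (ae_of_all _ fun y hy ↦ hle y hy)
    _ = 8 * (∫ y in s, X y ^ 4) + 8 * b ^ 4 * (volume : Measure _).real s := by
        rw [integral_add (hXint.const_mul 8) hcint, integral_const_mul, setIntegral_const,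
          smul_eq_mul, mul_comm ((volume : Measure _).real s)]
    _ ≤ 8 * (16 * a ^ 2 * (∫ w : EuclideanSpace ℝ (Fin 4), ((1 + ‖w‖ ^ 2) ^ 4)⁻¹) * K ^ 2) +
          8 * b ^ 4 * (volume : Measure _).real s := by gcongr
    _ = _ := by ring

end CapMetricVolumeSchwarzschild

open CapMetricVolume CapMetricVolumeSchwarzschild

/-- **Workhorse of S5'.** Green data `(g, p, G)` in the flat gauge with mass at `p`
(parameters `a > 0`, `b ≥ 0`, `r > 0`; `φ⁻¹` a `g`-isometry on `B̄(φ p, r)`,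
`G(φ⁻¹ y) = a/‖y − φ p‖² + b` there): there are `C₁, C₂` such that every smooth `ψ` with
`ψ = 4KG/(4K+G)` off `p` and `ψ p = 4K` (`K > 0`) has `∫ ψ⁴ dV_g ≤ C₁ + C₂ K²`. Here
`C₁ = C⁴ Vol_g(M) + 8 b⁴ vol(B̄)` with `|G| ≤ C` off the open chart ball, and
`C₂ = 128 a² ∫_{ℝ⁴} (1 + ‖w‖²)⁻⁴ dw`. [folklore] -/
theorem capMetricVolumeSchwarzschild_le
    {M : Type} [TopologicalSpace M] [T2Space M] [SecondCountableTopology M]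
    [ChartedSpace (EuclideanSpace ℝ (Fin 4)) M] [IsManifold (𝓡 4) ∞ M] [CompactSpace M]
    [T3Space M] [MeasurableSpace M] [BorelSpace M]
    (g : PseudoRiemannianMetric (𝓡 4) ∞ (EuclideanSpace ℝ (Fin 4)) (TangentSpace (𝓡 4) : M → Type _))
    [g.HasLeviCivita] (hg : g.IsRiemannian) (p : M) (G : M → ℝ)
    (hGs : ContMDiffOn (𝓡 4) 𝓘(ℝ, ℝ) ∞ G {p}ᶜ) (hGpos : ∀ x, x ≠ p → 0 < G x)
    {a b r : ℝ} (ha : 0 < a) (hb : 0 ≤ b) (hr : 0 < r)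
    (hsub : Metric.closedBall (extChartAt (𝓡 4) p p) r ⊆ (extChartAt (𝓡 4) p).target)
    (hflat : ∀ y ∈ Metric.closedBall (extChartAt (𝓡 4) p p) r, ∀ X W : EuclideanSpace ℝ (Fin 4),
      g.val ((extChartAt (𝓡 4) p).symm y)
        (mfderiv 𝓘(ℝ, EuclideanSpace ℝ (Fin 4)) (𝓡 4) (extChartAt (𝓡 4) p).symm y X)
        (mfderiv 𝓘(ℝ, EuclideanSpace ℝ (Fin 4)) (𝓡 4) (extChartAt (𝓡 4) p).symm y W) = ⟪X, W⟫)
    (hGa : ∀ y ∈ Metric.closedBall (extChartAt (𝓡 4) p p) r, y ≠ extChartAt (𝓡 4) p p →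
      G ((extChartAt (𝓡 4) p).symm y) = a / ‖y - extChartAt (𝓡 4) p p‖ ^ 2 + b) :
    ∃ C₁ C₂ : ℝ, ∀ (K : ℝ), 0 < K → ∀ (ψ : M → ℝ), ContMDiff (𝓡 4) 𝓘(ℝ, ℝ) ∞ ψ →
      (∀ x, x ≠ p → ψ x = 4 * K * G x / (4 * K + G x)) → ψ p = 4 * K →
      ∫ x, (ψ x) ^ 4 ∂(riemannianMeasure (g.toContMDiffRiemannianMetric hg)) ≤ C₁ + C₂ * K ^ 2 := by
  set φ := extChartAt (𝓡 4) p with hφ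
  set y₀ := φ p with hy₀
  set μ : Measure M := riemannianMeasure (g.toContMDiffRiemannianMetric hg) with hμ
  haveI : IsFiniteMeasure μ := isFiniteMeasure_riemannianMeasure _
  -- the closed chart ball `B` and the open chart ball `U ⊆ B` (`p ∈ U`)
  set B : Set M := {x | x ∈ φ.source ∧ φ x ∈ Metric.closedBall y₀ r} with hB
  have hBm : MeasurableSet B := by
    change MeasurableSet (φ.source ∩ φ ⁻¹' Metric.closedBall y₀ r)
    exact measurableSet_source_inter_preimage_extChartAt p Metric.isClosed_closedBall.measurableSet
  set U : Set M := φ.source ∩ φ ⁻¹' Metric.ball y₀ r with hU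
  have hUo : IsOpen U := isOpen_extChartAt_preimage' p Metric.isOpen_ball
  have hUB : U ⊆ B := fun x hx ↦ ⟨hx.1, Metric.ball_subset_closedBall hx.2⟩
  have hpU : p ∈ U := ⟨mem_extChartAt_source p, Metric.mem_ball_self hr⟩
  have hpB : p ∈ B := hUB hpU
  -- `|G| ≤ C` on the compact set `Uᶜ ⊆ M ∖ {p}`
  have hUc : IsCompact Uᶜ := hUo.isClosed_compl.isCompact
  have hGcont : ContinuousOn G Uᶜ :=
    hGs.continuousOn.mono (compl_subset_compl.2 (singleton_subset_iff.2 hpU))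
  obtain ⟨C, hC⟩ := hUc.exists_bound_of_continuousOn hGcont
  refine ⟨C ^ 4 * μ.real univ +
      8 * b ^ 4 * (volume : Measure (EuclideanSpace ℝ (Fin 4))).real (Metric.closedBall y₀ r),
    128 * a ^ 2 * (∫ w : EuclideanSpace ℝ (Fin 4), ((1 + ‖w‖ ^ 2) ^ 4)⁻¹), ?_⟩
  intro K hK ψ hψ hψG hψp
  have hψ4c : Continuous fun x ↦ ψ x ^ 4 := hψ.continuous.pow 4
  have hint : Integrable (fun x ↦ ψ x ^ 4) μ :=
    EntropyLocalisation.integrable_of_continuous g hg hψ4c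
  -- (i) off the chart ball: `0 ≤ ψ ≤ G ≤ C`
  have h1 : ∫ x in Bᶜ, ψ x ^ 4 ∂μ ≤ C ^ 4 * μ.real univ := by
    have hle : ∀ x ∈ Bᶜ, ‖ψ x ^ 4‖ ≤ C ^ 4 := by
      intro x hx
      have hxp : x ≠ p := fun h ↦ hx (h ▸ hpB)
      have hxU : x ∈ Uᶜ := fun h ↦ hx (hUB h)
      have hGx : 0 < G x := hGpos x hxp
      have hGC : G x ≤ C := (Real.le_norm_self _).trans (hC x hxU)
      have hψx : ψ x = 4 * K * G x / (4 * K + G x) := hψG x hxp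
      have hψ0 : 0 ≤ ψ x := by rw [hψx]; positivity
      have hψle : ψ x ≤ G x := by
        rw [hψx, div_le_iff₀ (by positivity)]
        nlinarith [sq_nonneg (G x)]
      rw [Real.norm_eq_abs, abs_of_nonneg (by positivity)]
      exact pow_le_pow_left₀ hψ0 (hψle.trans hGC) 4
    calc ∫ x in Bᶜ, ψ x ^ 4 ∂μ ≤ ‖∫ x in Bᶜ, ψ x ^ 4 ∂μ‖ := Real.le_norm_self _
      _ ≤ C ^ 4 * μ.real Bᶜ := norm_setIntegral_le_of_norm_le_const (measure_lt_top μ _) hle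
      _ ≤ C ^ 4 * μ.real univ :=
          mul_le_mul_of_nonneg_left (measureReal_mono (subset_univ _)) (by positivity)
  -- (ii) on the chart ball: S0b and the Euclidean estimate with mass
  have h2 : ∫ x in B, ψ x ^ 4 ∂μ ≤
      8 * b ^ 4 * (volume : Measure (EuclideanSpace ℝ (Fin 4))).real (Metric.closedBall y₀ r) +
        128 * a ^ 2 * (∫ w : EuclideanSpace ℝ (Fin 4), ((1 + ‖w‖ ^ 2) ^ 4)⁻¹) * K ^ 2 := by
    rw [stub_setIntegralFlatChart M g hg p r hr hsub hflat _ hψ4c]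
    refine setIntegral_pow_four_le y₀ ha hK (fun y ↦ ψ (φ.symm y)) (fun y hy ↦ ?_)
      fun y hy ↦ ?_
    · -- `0 ≤ ψ (φ⁻¹ y)`
      by_cases hyy : y = y₀
      · rw [hyy, hy₀, hφ, extChartAt_to_inv p, hψp]
        positivity
      · have hyt : y ∈ φ.target := hsub hy
        have hxp : φ.symm y ≠ p := by
          intro h
          exact hyy ((φ.right_inv hyt).symm.trans (by rw [h]))
        rw [hψG _ hxp]
        have hGx : 0 < G (φ.symm y) := hGpos _ hxp
        positivity
    · -- `ψ (φ⁻¹ y) ≤ 4Ka/(4K‖y − y₀‖² + a) + b`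
      by_cases hyy : y = y₀
      · rw [hyy, hy₀, hφ, extChartAt_to_inv p, hψp, sub_self, norm_zero, zero_pow two_ne_zero,
          mul_zero, zero_add, mul_div_assoc, div_self ha.ne', mul_one]
        linarith
      · have hyt : y ∈ φ.target := hsub hy
        have hxp : φ.symm y ≠ p := by
          intro h
          exact hyy ((φ.right_inv hyt).symm.trans (by rw [h]))
        have hd : ‖y - y₀‖ ≠ 0 := norm_ne_zero_iff.2 (sub_ne_zero.2 hyy)
        rw [hψG _ hxp, hGa y hy hyy]
        exact capProfile_le hK ha hb hd
  -- assemble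
  rw [← integral_add_compl hBm hint]
  linarith

/-- **S5' — the volume of the capped metric grows like `K²` (Schwarzschild gauge, registered
form).** Flat gauge with mass at `p`, Green data `(g, p, G)` with `G(φ⁻¹ y) = a/‖y − φ p‖² + b`
on the chart ball (`a > 0`, `b ≥ 0`). There are `C₁, C₂` (independent of `K`) such that every
smooth `ψ` with `ψ = 4KG/(4K+G)` off `p` and `ψ p = 4K` (`K > 0`) has `∫ ψ⁴ dV_g ≤ C₁ + C₂ K²`.
The chart-ball volume identity is S0b `stub_setIntegralFlatChart`. [folklore] -/
theorem stub_capMetricVolumeSchwarzschild :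
    ∀ (M : Type) [TopologicalSpace M] [T2Space M] [SecondCountableTopology M]
      [ChartedSpace (EuclideanSpace ℝ (Fin 4)) M] [IsManifold (𝓡 4) ∞ M] [CompactSpace M]
      [T3Space M] [MeasurableSpace M] [BorelSpace M]
      (g : PseudoRiemannianMetric (𝓡 4) ∞ (EuclideanSpace ℝ (Fin 4)) (TangentSpace (𝓡 4) : M → Type _))
      [g.HasLeviCivita] (hg : g.IsRiemannian) (p : M) (G : M → ℝ),
        (ContMDiffOn (𝓡 4) 𝓘(ℝ, ℝ) ∞ G {p}ᶜ ∧ (∀ x, x ≠ p → 0 < G x) ∧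
          (∀ x, x ≠ p → g.scalarCurvature x * G x - 6 * g.dalembertian G x = 0) ∧
          Tendsto G (𝓝[≠] p) atTop) →
      ∀ (a b r : ℝ), 0 < a → 0 ≤ b → 0 < r →
        Metric.closedBall (extChartAt (𝓡 4) p p) r ⊆ (extChartAt (𝓡 4) p).target →
        (∀ y ∈ Metric.closedBall (extChartAt (𝓡 4) p p) r, ∀ X W : EuclideanSpace ℝ (Fin 4),
          g.val ((extChartAt (𝓡 4) p).symm y)
            (mfderiv 𝓘(ℝ, EuclideanSpace ℝ (Fin 4)) (𝓡 4) (extChartAt (𝓡 4) p).symm y X)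
            (mfderiv 𝓘(ℝ, EuclideanSpace ℝ (Fin 4)) (𝓡 4) (extChartAt (𝓡 4) p).symm y W) = ⟪X, W⟫) →
        (∀ y ∈ Metric.closedBall (extChartAt (𝓡 4) p p) r, y ≠ extChartAt (𝓡 4) p p →
          G ((extChartAt (𝓡 4) p).symm y) = a / ‖y - extChartAt (𝓡 4) p p‖ ^ 2 + b) →
      ∃ C₁ C₂ : ℝ, ∀ (K : ℝ), 0 < K → ∀ (ψ : M → ℝ), ContMDiff (𝓡 4) 𝓘(ℝ, ℝ) ∞ ψ →
        (∀ x, x ≠ p → ψ x = 4 * K * G x / (4 * K + G x)) → ψ p = 4 * K →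
        ∫ x, (ψ x) ^ 4 ∂(riemannianMeasure (g.toContMDiffRiemannianMetric hg)) ≤ C₁ + C₂ * K ^ 2 := by
  intro M _ _ _ _ _ _ _ _ _ g _ hg p G hG a b r ha hb hr hsub hflat hGa
  exact capMetricVolumeSchwarzschild_le g hg p G hG.1 hG.2.1 ha hb hr hsub hflat hGa

end Summit.SmoothPoincare4.SmoothPoincare4.Theorems

end
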